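import Summits.ResolutionOfSingularities.ResolutionOfSingularities.Theorems.PurelyInseparableDim4WinCertSound
import Summits.ResolutionOfSingularities.ResolutionOfSingularities.Theorems.PurelyInseparableDim4InScopeWinCert
import Summits.ResolutionOfSingularities.ResolutionOfSingularities.Theorems.PurelyInseparableDim4ScopeCover
import Summits.ResolutionOfSingularities.ResolutionOfSingularities.Theorems.PurelyInseparableDim4ScopeBlindRationalNorm
import Summits.ResolutionOfSingularities.ResolutionOfSingularities.Theorems.PurelyInseparableDim4TrapBaseChange
import Summits.ResolutionOfSingularities.ResolutionOfSingularities.Theorems.PurelyInseparableDim4EquimultipleScope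
import Summits.ResolutionOfSingularities.ResolutionOfSingularities.Theorems.PurelyInseparableDim4IsolationConverse
import Mathlib.FieldTheory.Finite.Basic
import HarnessLib
import HarnessLib.Audit.Tags

/-!
# Purely inseparable fourfolds — WIN CERTIFICATES VALID OVER EVERY FIELD OF CHARACTERISTIC `p`
# («RATIONALITY-FORCED rows»: removing the «over 𝔽_p» rider of the F4-C kernel half where it can be removed)
# [OURS · counted 0 · a certificate format for OUR frame v4, not about resolution]

Census cell «res-dim4-pi» (D-0157 DOOR 2), width seat `res-dim4-p-14` (generation 2); sequel of PR-12t/12u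
(`WinCertSound`, `InScopeWinCert`).  Desk WORD #49 (a) made the rider «`𝔽₂`-rational replies only — no ascent to
`𝔽₄`/`K̄`» mandatory on every F4-C kernel sentence: the landed certificates (`winCertB` / `iwinCertB`: typ-3g7's
`…BatchW1–3`, p-13's `…BandWin1–14`) enumerate player B's replies `b ∈ 𝔽₂⁴` only, while the frame's statements
(`TerminatesSomeRule`, `TerminatesInScope`) ask for EVERY field of characteristic `p` (idea-10 g2's CARD I-10-3
measures the gap).  This file closes the gap for the rows where a finite check closes it:
* **Hasse–Taylor.** `b` is an equimultiple point of the `x_j`-chart iff every Hasse derivative `D^{(α)}G`,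
  `0 < |α| < q`, of the chart transform `G` vanishes at `b` (tree:
  `Equimultiple.isEquimultiplePoint_iff_mem_zeroLocus_singLocusIdeal`).  A **rationality witness** for `(G, j, i)`
  is an explicit identity `Σ_α g_α · D^{(α)}G + h · x_j = (x_i^p − x_i)^N` in `k[x₁..x₄]` (`RatWit`, checked on term
  lists by `ratWitB`); it forces `b_i^p = b_i`, i.e. `b_i ∈ 𝔽_p`, at every equimultiple `K`-point `b` of the chart
  with `b_j = 0`, for EVERY field `K ⊇ 𝔽_p` (`pow_eq_zero_of_ratWitB`, `exists_eq_cast_of_pow_char_eq`).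
* **Format** `UCert k = List ((SData 4 k × Finset (Fin 4)) × List (RatWit k))`: PR-12t's full-game rows plus, for
  every A-row, witnesses for every chart `j ∈ S` and coordinate `i ≠ j` (`ratOK`); checker `uwinCertB p q`
  (`urowOK` = PR-12t's `rowOK` ∧ `ratOK`, or a non-`q`-fold origin); `winCertB_of_uwinCertB`.
* **SOUNDNESS OVER EVERY FIELD** `stateWins_map_of_uwinCertB`: for `T : UCert (ZMod p)` with `uwinCertB p q T`,
  every field `K` of characteristic `p` and `f : ZMod p →+* K`, every row state `s ⊗ K` is ESCAPABLE (`StateWins q`,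
  FULL coordinate game, B ranging over ALL of `K⁴`): an equimultiple `K`-reply is `𝔽_p`-rational by the witnesses,
  hence one the `𝔽_p` certificate already answers (p-14 g0's `BaseChange.step_map` /
  `isEquimultiplePoint_map_ringHom_iff` / `isPermissibleCentre_map_iff`); `forall_stateWins_of_uwinCertB` (`∀ K`,
  `ZMod.castHom`) and `forall_inScopeStateWins_of_uwinCertB` (in-scope escapable over every `K`).
* ACCEPTANCE (`decide`, `p = q = 2`): three of typ-3g7's W1 certificates (roots `x₃x₄³ + x₁x₂x₄²`, `x₄³ + x₃x₄`,
  `x₄³ + x₃x₄²`) with witnesses (`ucertsW1a`) ⇒ escapable over EVERY field of characteristic 2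
  (`forall_stateWins_ucertsW1a`).  MEASURED (seat instrument, not a kernel fact): 269 of the 441 W1–W3 roots and
  149 of the first 223 BandWin roots admit witnesses on every row (blind leaves aside); the others have a chart whose
  equimultiple locus has non-rational points (`𝔽₄`, `𝔽₂(t)`) — there the rider is genuine (idea-10's «holes»).
NOT here: blindness leaves (this is the FULL game, which needs none).  Nothing here proves resolution of
singularities in dimension ≥ 4 / characteristic `p`; counted 0; AI work, weaker than expert review.
bears_on: LADDER-RESOLUTION:D157-DOOR2 (res-dim4-pi · PR-12u sequel · F4-C instrument · the ∀K gap).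
Supports stmt-ResolutionOfSingularities-16155 (helper).
-/

set_option linter.dupNamespace false

noncomputable section
open MvPolynomial Finset
open scoped BigOperators
namespace Summit.ResolutionOfSingularities.ResolutionOfSingularities.Theorems.PIDim4

namespace WinCertAllFields

open Literature.AlgebraicGeometry.Resolution
open Literature.AlgebraicGeometry.Resolution.CentreBlowup
open StepKit WinCertSound InScopeWinCert ScopeCover ScopeBlind

variable {k : Type} [Field k] [DecidableEq k]

/-! ## 1. Rationality witnesses -/
/-- A **rationality witness** for the chart `x_j` and the coordinate `x_i`: exponent `N`, cofactors `g_α`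
(indexed by Hasse multi-indices `α`) and `h`, claiming `Σ_α g_α · D^{(α)}G + h · x_j = (x_i^p − x_i)^N`.
[folklore] -/
structure RatWit (k : Type) where
  /-- the chart variable -/
  j : Fin 4
  /-- the coordinate forced rational -/
  i : Fin 4
  /-- the exponent `N` -/
  N : ℕ
  /-- cofactors of the Hasse derivatives, as (multi-index, term list) -/
  gs : List ((Fin 4 → ℕ) × Terms 4 k)
  /-- cofactor of `x_j` -/
  h : Terms 4 k

/-- The exponent vector `m · e_i`. [folklore] -/
def unitE (i : Fin 4) (m : ℕ) : Fin 4 → ℕ := fun l => if l = i then m else 0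
/-- The term list of `x_i^p − x_i`. [folklore] -/
def xPowSubX (p : ℕ) (i : Fin 4) : Terms 4 k := [(unitE i p, 1), (unitE i 1, -1)]

/-- `Σ_α g_α · D^{(α)}G` on term lists (`hasseL`, `mulL`). [folklore] -/
def sumHasseL (G : Terms 4 k) : List ((Fin 4 → ℕ) × Terms 4 k) → Terms 4 k
  | [] => []
  | ag :: rest => mulL ag.2 (hasseL ag.1 G) ++ sumHasseL G rest

/-- The left-hand side `Σ_α g_α · D^{(α)}G + h · x_j` of a witness, on term lists. [folklore] -/
def witLHS (G : Terms 4 k) (w : RatWit k) : Terms 4 k :=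
  sumHasseL G w.gs ++ mulL w.h [(unitE w.j 1, 1)]

/-- **Checking a rationality witness**: every multi-index used has `0 < |α| < q`, and the claimed identity
holds (compared after collecting terms). [folklore] -/
def ratWitB (p q : ℕ) (G : Terms 4 k) (w : RatWit k) : Bool :=
  (w.gs.all fun ag => decide (0 < ∑ l, ag.1 l ∧ ∑ l, ag.1 l < q)) &&
    StepKit.equivB (normL (witLHS G w)) (normL (powL (xPowSubX p w.i) w.N))

omit [DecidableEq k] in
/-- Evaluation of a monomial term under `eval₂Hom f b`. [folklore] -/
theorem eval₂Hom_monomial_expo {K : Type} [Field K] (f : k →+* K) (b : Fin 4 → K) (e : Fin 4 → ℕ) (c : k) :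
    eval₂Hom f b (monomial (expo e) c) = f c * ∏ l, b l ^ e l := by
  rw [monomial_expo_eq, map_mul, eval₂Hom_C, map_prod]
  simp only [map_pow, eval₂Hom_X']

omit [DecidableEq k] in
/-- `∏_l b_l^{(m·e_i)_l} = b_i^m`. [folklore] -/
theorem prod_pow_unitE {K : Type} [Field K] (b : Fin 4 → K) (i : Fin 4) (m : ℕ) :
    ∏ l, b l ^ unitE i m l = b i ^ m := by
  rw [Finset.prod_eq_single i (fun l _ hl => by simp [unitE, hl]) (fun h => absurd (Finset.mem_univ i) h)]
  simp [unitE]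

omit [DecidableEq k] in
/-- `eval₂Hom f b (x_i^p − x_i) = b_i^p − b_i`. [folklore] -/
theorem eval₂Hom_xPowSubX {K : Type} [Field K] (f : k →+* K) (b : Fin 4 → K) (p : ℕ) (i : Fin 4) :
    eval₂Hom f b (evalT (xPowSubX (k := k) p i)) = b i ^ p - b i := by
  simp only [xPowSubX, evalT_cons, evalT_nil, map_add, add_zero, eval₂Hom_monomial_expo, prod_pow_unitE,
    map_one, one_mul, map_neg, pow_one]
  ring

omit [DecidableEq k] in
/-- `eval₂Hom f b (Σ_α g_α · D^{(α)}G) = 0` when every `D^{(α)}G` used vanishes at `b` after `f`. [folklore] -/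
theorem eval₂Hom_sumHasseL_eq_zero {K : Type} [Field K] (f : k →+* K) (b : Fin 4 → K) (G : Terms 4 k) :
    ∀ (gs : List ((Fin 4 → ℕ) × Terms 4 k)),
      (∀ ag ∈ gs, eval₂Hom f b (hasseDeriv (expo ag.1) (evalT G)) = 0) →
        eval₂Hom f b (evalT (sumHasseL G gs)) = 0
  | [], _ => by simp [sumHasseL]
  | ag :: rest, h => by
    rw [sumHasseL, evalT_append, map_add, evalT_mulL, map_mul, ← hasseDeriv_evalT,
      h ag List.mem_cons_self, mul_zero, zero_add]
    exact eval₂Hom_sumHasseL_eq_zero f b G rest fun ag' h' => h ag' (List.mem_cons_of_mem _ h')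

/-- **Soundness of a rationality witness**: at a `K`-point `b` with `b_j = 0` where every Hasse derivative
`D^{(α)}G`, `0 < |α| < q`, vanishes (after the coefficient map `f`), one has `(b_i^p − b_i)^N = 0`. [folklore] -/
theorem pow_eq_zero_of_ratWitB {p q : ℕ} {G : Terms 4 k} {w : RatWit k} (hw : ratWitB p q G w = true)
    {K : Type} [Field K] (f : k →+* K) (b : Fin 4 → K) (hbj : b w.j = 0)
    (hzero : ∀ α : Fin 4 → ℕ, 0 < ∑ l, α l → ∑ l, α l < q →
      eval₂Hom f b (hasseDeriv (expo α) (evalT G)) = 0) :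
    (b w.i ^ p - b w.i) ^ w.N = 0 := by
  unfold ratWitB at hw
  rw [Bool.and_eq_true, List.all_eq_true] at hw
  obtain ⟨hdeg, hequiv⟩ := hw
  have hid : evalT (witLHS G w) = evalT (powL (xPowSubX p w.i) w.N) := by
    rw [← evalT_normL (witLHS G w), ← evalT_normL (powL _ _)]
    exact (evalT_eq_iff_equivB _ _).mpr hequiv
  have hl : eval₂Hom f b (evalT (witLHS G w)) = 0 := by
    rw [witLHS, evalT_append, map_add, evalT_mulL, map_mul]
    rw [eval₂Hom_sumHasseL_eq_zero f b G w.gs fun ag hag => ?_]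
    · simp only [evalT_cons, evalT_nil, add_zero, eval₂Hom_monomial_expo, prod_pow_unitE, pow_one, hbj,
        map_one, mul_zero]
    · have hd := of_decide_eq_true (hdeg ag hag)
      exact hzero ag.1 hd.1 hd.2
  have hr : eval₂Hom f b (evalT (powL (xPowSubX p w.i) w.N)) = (b w.i ^ p - b w.i) ^ w.N := by
    rw [evalT_powL, map_pow, eval₂Hom_xPowSubX]
  rw [← hr, ← hid, hl]

/-- In a field of characteristic `p`, `x^p = x` forces `x ∈ 𝔽_p` (Mathlib: the prime subfield is the set of
fixed points of Frobenius). [folklore] -/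
theorem exists_eq_cast_of_pow_char_eq {p : ℕ} [Fact p.Prime] {K : Type} [Field K] [CharP K p]
    (f : ZMod p →+* K) {x : K} (hx : x ^ p = x) : ∃ c : ZMod p, f c = x := by
  have hmem : x ∈ (⊥ : Subfield K) := (Subfield.mem_bot_iff_pow_eq_self K p).mpr hx
  rw [← ZMod.fieldRange_castHom_eq_bot p, RingHom.mem_fieldRange] at hmem
  obtain ⟨c, hc⟩ := hmem
  exact ⟨c, by rw [Subsingleton.elim f (ZMod.castHom (dvd_refl p) K)]; exact hc⟩

/-- From `(x^p − x)^N = 0`: `x ∈ 𝔽_p`. [folklore] -/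
theorem exists_eq_cast_of_pow_eq_zero {p : ℕ} [Fact p.Prime] {K : Type} [Field K] [CharP K p]
    (f : ZMod p →+* K) {x : K} {N : ℕ} (hx : (x ^ p - x) ^ N = 0) : ∃ c : ZMod p, f c = x := by
  rcases Nat.eq_zero_or_pos N with h0 | hpos
  · rw [h0, pow_zero] at hx; exact absurd hx one_ne_zero
  · exact exists_eq_cast_of_pow_char_eq f (sub_eq_zero.mp (pow_eq_zero_iff hpos.ne' |>.mp hx))

/-! ## 2. The certificate format -/
/-- A row: PR-12t's `(presented state, A's centre)` plus rationality witnesses. [folklore] -/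
abbrev URow (k : Type) : Type := WRow k × List (RatWit k)
/-- A certificate: rows, children LATER in the list. [folklore] -/
abbrev UCert (k : Type) : Type := List (URow k)

/-- **Rationality check of a row**: for every chart `j ∈ S` and every coordinate `i ≠ j` some witness passes on the
chart transform `chartL q S j L`. [folklore] -/
def ratOK (p q : ℕ) (row : URow k) : Bool :=
  decide (∀ j ∈ row.1.2, ∀ i : Fin 4, i ≠ j →
    ∃ w ∈ row.2, w.j = j ∧ w.i = i ∧ ratWitB p q (chartL q row.1.2 j row.1.1.L) w = true)

variable [Fintype k]

/-- The row check: origin not `q`-fold, or (PR-12t's `rowOK` over `k` and the rationality check). [folklore] -/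
def urowOK (p q : ℕ) (rest : UCert k) (row : URow k) : Bool :=
  !(permB q Finset.univ row.1.1.L) || (rowOK q (rest.map Prod.fst) row.1 && ratOK p q row)

/-- **The checker.** [folklore] -/
def uwinCertB (p q : ℕ) : UCert k → Bool
  | [] => true
  | row :: rest => urowOK p q rest row && uwinCertB p q rest

/-- A passing row passes PR-12t's row check. [folklore] -/
theorem rowOK_of_urowOK {p q : ℕ} {rest : UCert k} {row : URow k} (h : urowOK p q rest row = true) :
    rowOK q (rest.map Prod.fst) row.1 = true := by
  unfold urowOK at h
  rw [Bool.or_eq_true, Bool.and_eq_true] at h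
  unfold rowOK
  rw [Bool.or_eq_true]
  rcases h with ht | ⟨hr, -⟩
  · exact Or.inl ht
  · unfold rowOK at hr
    rw [Bool.or_eq_true] at hr
    exact hr

/-- **The `𝔽_p` certificate is inside**: forgetting the witnesses gives a checked PR-12t certificate. [folklore] -/
theorem winCertB_of_uwinCertB {p q : ℕ} : ∀ {T : UCert k}, uwinCertB p q T = true → winCertB q (T.map Prod.fst) = true
  | [], _ => rfl
  | row :: rest, h => by
    unfold uwinCertB at h
    rw [Bool.and_eq_true] at h
    rw [List.map_cons]
    unfold winCertB
    rw [Bool.and_eq_true]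
    exact ⟨rowOK_of_urowOK h.1, winCertB_of_uwinCertB h.2⟩

/-! ## 3. Soundness over every field of characteristic `p` -/
omit [DecidableEq k] [Fintype k] in
/-- The chart transform commutes with the coefficient map (cf. the tree's private
`CentreBlowup.map_chartTransform`). [folklore] -/
theorem chartTransform_map {K : Type} [Field K] (f : k →+* K) (q : ℕ) (S : Finset (Fin 4)) (j : Fin 4)
    (F : MvPolynomial (Fin 4) k) :
    chartTransform q S j (MvPolynomial.map f F) = MvPolynomial.map f (chartTransform q S j F) := by
  unfold chartTransform
  rw [map_sum, support_map_of_injective F f.injective]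
  refine Finset.sum_congr rfl fun d _ => ?_
  rw [map_monomial, coeff_map]

omit [DecidableEq k] [Fintype k] in
/-- **Hasse–Taylor at an equimultiple point**: if `b` is an equimultiple `K`-point of the `x_j`-chart for the
state `s ⊗ K`, every `D^{(α)}G`, `0 < |α| < q`, of the chart transform `G` of `s` vanishes at `b` (after `f`).
[folklore] -/
theorem eval₂Hom_hasseDeriv_eq_zero_of_isEquimultiplePoint {K : Type} [Field K] [DecidableEq K] (f : k →+* K)
    {q : ℕ} {S : Finset (Fin 4)} {j : Fin 4} {b : Fin 4 → K} (s : SData 4 k)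
    (heq : IsEquimultiplePoint q S j b (⟨MvPolynomial.map f s.toState.F, s.toState.r, s.toState.exc⟩ : State K))
    (α : Fin 4 → ℕ) (h0 : 0 < ∑ l, α l) (hq : ∑ l, α l < q) :
    eval₂Hom f b (hasseDeriv (expo α) (evalT (chartL q S j s.L))) = 0 := by
  have hz := (Equimultiple.isEquimultiplePoint_iff_mem_zeroLocus_singLocusIdeal q S j b _).mp heq
  rw [MvPolynomial.mem_zeroLocus_iff] at hz
  have hmem : hasseDeriv (expo α) (chartTransform q S j (MvPolynomial.map f s.toState.F)) ∈
      singLocusIdeal q (chartTransform q S j (MvPolynomial.map f s.toState.F)) :=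
    Ideal.subset_span ⟨expo α, by rw [degree_expo]; exact h0, by rw [degree_expo]; exact hq, rfl⟩
  have h1 := hz _ hmem
  rw [SData.toState_F, chartTransform_map, chartTransform_evalT, IsolationConverse.hasseDeriv_map,
    MvPolynomial.aeval_def, MvPolynomial.eval₂_map] at h1
  rw [coe_eval₂Hom]
  have hcomp : (algebraMap K K).comp f = f := RingHom.ext fun x => rfl
  rw [hcomp] at h1
  exact h1

/-- **An equimultiple reply is rational** when the row carries witnesses for its chart: every equimultiple
`K`-point `b` (`b_j = 0`) of a chart `j ∈ S` is `f ∘ b₀` for a `k`-point `b₀` with `b₀ j = 0`. [folklore] -/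
theorem exists_rational_of_ratOK {p : ℕ} [Fact p.Prime] {q : ℕ} {K : Type} [Field K] [CharP K p] [DecidableEq K]
    (f : ZMod p →+* K) {row : URow (ZMod p)} (hrat : ratOK p q row = true) {j : Fin 4} (hj : j ∈ row.1.2)
    {b : Fin 4 → K} (hbj : b j = 0)
    (heq : IsEquimultiplePoint q row.1.2 j b
      (⟨MvPolynomial.map f row.1.1.toState.F, row.1.1.toState.r, row.1.1.toState.exc⟩ : State K)) :
    ∃ b₀ : Fin 4 → ZMod p, b₀ j = 0 ∧ f ∘ b₀ = b := by
  unfold ratOK at hrat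
  have hall := of_decide_eq_true hrat
  have hcoord : ∀ i : Fin 4, ∃ c : ZMod p, f c = b i := by
    intro i
    by_cases hij : i = j
    · exact ⟨0, by rw [map_zero, hij, hbj]⟩
    · obtain ⟨w, -, hwj, hwi, hw⟩ := hall j hj i hij
      have hpow := pow_eq_zero_of_ratWitB hw f b (by rw [hwj]; exact hbj)
        (fun α h0 hq => eval₂Hom_hasseDeriv_eq_zero_of_isEquimultiplePoint f row.1.1 heq α h0 hq)
      rw [hwi] at hpow
      exact exists_eq_cast_of_pow_eq_zero f hpow
  choose b₀ hb₀ using hcoord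
  refine ⟨b₀, ?_, funext fun i => hb₀ i⟩
  have h0 : f (b₀ j) = f 0 := by rw [hb₀ j, hbj, map_zero]
  exact f.injective h0

/-- **SOUNDNESS of one row over `K`.** [folklore] -/
theorem stateWins_map_of_urowOK {p : ℕ} [Fact p.Prime] {q : ℕ} {K : Type} [Field K] [CharP K p] [DecidableEq K]
    (f : ZMod p →+* K) {rest : UCert (ZMod p)}
    (hrest : ∀ r ∈ rest, StateWins q
      (⟨MvPolynomial.map f r.1.1.toState.F, r.1.1.toState.r, r.1.1.toState.exc⟩ : State K))
    {row : URow (ZMod p)} (h : urowOK p q rest row = true) :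
    StateWins q (⟨MvPolynomial.map f row.1.1.toState.F, row.1.1.toState.r, row.1.1.toState.exc⟩ : State K) := by
  unfold urowOK at h
  rw [Bool.or_eq_true] at h
  -- terminal rows
  have hterm : permB q Finset.univ row.1.1.L = false →
      StateWins q (⟨MvPolynomial.map f row.1.1.toState.F, row.1.1.toState.r, row.1.1.toState.exc⟩ : State K) := by
    intro hperm
    refine Game.Wins.terminal fun S hS => ?_
    have hS' := (BaseChange.isPermissibleCentre_map_iff f q S row.1.1.toState.F).mp hS
    exact no_permissible_of_not_permB hperm S hS'
  rcases h with ht | hm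
  · exact hterm (by rw [Bool.not_eq_true'] at ht; exact ht)
  rw [Bool.and_eq_true] at hm
  obtain ⟨hrow, hrat⟩ := hm
  unfold rowOK at hrow
  rw [Bool.or_eq_true] at hrow
  rcases hrow with ht | hmove
  · exact hterm (by rw [Bool.not_eq_true'] at ht; exact ht)
  rw [Bool.and_eq_true, decide_eq_true_eq] at hmove
  obtain ⟨hS, hall⟩ := hmove
  have hperm : IsPermissibleCentre q row.1.2 row.1.1.toState.F := (isPermissibleCentre_iff q row.1.2 row.1.1.L).mpr hS
  refine Game.Wins.move (m := row.1.2) ((BaseChange.isPermissibleCentre_map_iff f q row.1.2 _).mpr hperm) ?_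
  rintro s' ⟨j, b, hj, hbj, heq, hne, rfl⟩
  -- the reply is rational
  obtain ⟨b₀, hb₀j, rfl⟩ := exists_rational_of_ratOK f hrat hj hbj heq
  have heq₀ : IsEquimultiplePoint q row.1.2 j b₀ row.1.1.toState :=
    (BaseChange.isEquimultiplePoint_map_ringHom_iff f q row.1.2 j b₀ row.1.1.toState).mp heq
  have hstep := BaseChange.step_map f q row.1.2 j b₀ row.1.1.toState
  have h := hall j hj b₀ hb₀j
  unfold replyOK at h
  rw [Bool.or_eq_true, Bool.or_eq_true] at h
  rcases h with (h1 | h2) | h3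
  · -- not equimultiple over `k`: contradiction
    rw [Bool.not_eq_true', ← Bool.not_eq_true] at h1
    exact absurd ((isEquimultiplePoint_iff q row.1.2 j b₀ row.1.1).mp heq₀) h1
  · -- zero child over `k`: contradiction with `F' ≠ 0` over `K`
    exfalso
    apply hne
    rw [hstep]
    show MvPolynomial.map f (step q row.1.2 j b₀ row.1.1.toState).F = 0
    have hz : (step q row.1.2 j b₀ row.1.1.toState).F = 0 := by
      by_contra hnz
      have := (step_F_ne_zero_iff q row.1.2 j b₀ row.1.1).mp hnz
      rw [h2] at this
      exact Bool.noConfusion this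
    rw [hz, map_zero]
  · -- child certified later
    obtain ⟨r, hr, hrc⟩ := exists_of_childIn h3
    obtain ⟨ur, hur, rfl⟩ := List.mem_map.mp hr
    rw [hstep, step_toState, hrc]
    exact hrest ur hur

/-- **SOUNDNESS OVER EVERY FIELD OF CHARACTERISTIC `p`**: every row state of a checked certificate, base-changed
along `f : 𝔽_p → K`, is ESCAPABLE in the full coordinate game over `K` (player B ranging over all `K`-rational
chart points). [folklore] -/
theorem stateWins_map_of_uwinCertB {p : ℕ} [Fact p.Prime] {q : ℕ} {K : Type} [Field K] [CharP K p]
    [DecidableEq K] (f : ZMod p →+* K) :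
    ∀ {T : UCert (ZMod p)}, uwinCertB p q T = true →
      ∀ row ∈ T, StateWins q
        (⟨MvPolynomial.map f row.1.1.toState.F, row.1.1.toState.r, row.1.1.toState.exc⟩ : State K)
  | [], _ => fun row hrow => absurd hrow List.not_mem_nil
  | row :: rest, h => by
    unfold uwinCertB at h
    rw [Bool.and_eq_true] at h
    have hrest := stateWins_map_of_uwinCertB f h.2
    intro r hr
    rcases List.mem_cons.mp hr with rfl | hr'
    · exact stateWins_map_of_urowOK f hrest h.1
    · exact hrest r hr'

/-- **`∀ K` form**: for every field `K` of characteristic `p`, every row state `⊗ K` of a checked certificate is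
escapable (coefficient map `ZMod.castHom`). [folklore] -/
theorem forall_stateWins_of_uwinCertB {p : ℕ} [Fact p.Prime] {q : ℕ} {T : UCert (ZMod p)}
    (h : uwinCertB p q T = true) (K : Type) [Field K] [CharP K p] [DecidableEq K] :
    ∀ row ∈ T, StateWins q
      (⟨MvPolynomial.map (ZMod.castHom (dvd_refl p) K) row.1.1.toState.F, row.1.1.toState.r,
        row.1.1.toState.exc⟩ : State K) :=
  stateWins_map_of_uwinCertB (ZMod.castHom (dvd_refl p) K) h

/-- Hence IN-SCOPE escapable over every field of characteristic `p` (F4-C game, `InScopeStateWins`). [folklore] -/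
theorem forall_inScopeStateWins_of_uwinCertB {p : ℕ} [Fact p.Prime] {q : ℕ} {T : UCert (ZMod p)}
    (h : uwinCertB p q T = true) (K : Type) [Field K] [CharP K p] [DecidableEq K] :
    ∀ row ∈ T, InScopeStateWins q
      (⟨MvPolynomial.map (ZMod.castHom (dvd_refl p) K) row.1.1.toState.F, row.1.1.toState.r,
        row.1.1.toState.exc⟩ : State K) :=
  fun row hrow => inScopeStateWins_of_stateWins (forall_stateWins_of_uwinCertB h K row hrow)

/-! ## 4. Acceptance over every field of characteristic 2: three of typ-3g7's W1 roots -/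
/-- Three W1 certificates (roots S1a-eab2e0d314 `x₃x₄³ + x₁x₂x₄²`, S1a-aea19d956f `x₄³ + x₃x₄`, S1a-249d1d49dd
`x₄³ + x₃x₄²`; rows as landed in `…InScopeWinCertBatchW1`, blindness slot dropped) with rationality witnesses found
by linear algebra over `𝔽₂` (seat instrument `ratwit.py`). [folklore] -/
def ucertsW1a : List (UCert (ZMod 2)) := [
  [((⟨[(![0, 0, 1, 3], 1), (![1, 1, 0, 2], 1)], ![0, 0, 0, 0], ∅⟩, {3}), [⟨3, 0, 1, [(![0, 1, 0, 0], [(![0, 0, 0, 0], 1), (![1, 0, 0, 0], 1)])], []⟩, ⟨3, 1, 1, [(![1, 0, 0, 0], [(![0, 0, 0, 0], 1), (![0, 1, 0, 0], 1)])], []⟩, ⟨3, 2, 1, [(![0, 0, 0, 1], [(![0, 0, 0, 0], 1), (![0, 0, 1, 0], 1)])], []⟩]),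
   ((⟨[(![0, 0, 1, 1], 1), (![1, 1, 0, 0], 1)], ![0, 0, 0, 0], {3}⟩, {0, 1, 2, 3}), [⟨0, 1, 1, [(![0, 1, 0, 0], [(![0, 1, 0, 0], 1), (![0, 2, 0, 0], 1)])], []⟩, ⟨0, 2, 1, [(![0, 1, 0, 0], [(![0, 0, 1, 0], 1)]), (![0, 0, 0, 1], [(![0, 0, 1, 0], 1)])], []⟩, ⟨0, 3, 1, [(![0, 1, 0, 0], [(![0, 0, 0, 1], 1)]), (![0, 0, 1, 0], [(![0, 0, 0, 1], 1)])], []⟩, ⟨1, 0, 1, [(![1, 0, 0, 0], [(![1, 0, 0, 0], 1), (![2, 0, 0, 0], 1)])], []⟩, ⟨1, 2, 1, [(![1, 0, 0, 0], [(![0, 0, 1, 0], 1)]), (![0, 0, 0, 1], [(![0, 0, 1, 0], 1)])], []⟩, ⟨1, 3, 1, [(![1, 0, 0, 0], [(![0, 0, 0, 1], 1)]), (![0, 0, 1, 0], [(![0, 0, 0, 1], 1)])], []⟩, ⟨2, 0, 1, [(![0, 1, 0, 0], [(![0, 0, 0, 0], 1), (![1, 0, 0, 0], 1)])], []⟩,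 ⟨2, 1, 1, [(![1, 0, 0, 0], [(![0, 0, 0, 0], 1), (![0, 1, 0, 0], 1)])], []⟩, ⟨2, 3, 1, [(![0, 0, 0, 1], [(![0, 0, 0, 1], 1), (![0, 0, 0, 2], 1)])], []⟩, ⟨3, 0, 1, [(![0, 1, 0, 0], [(![0, 0, 0, 0], 1), (![1, 0, 0, 0], 1)])], []⟩, ⟨3, 1, 1, [(![1, 0, 0, 0], [(![0, 0, 0, 0], 1), (![0, 1, 0, 0], 1)])], []⟩, ⟨3, 2, 1, [(![0, 0, 1, 0], [(![0, 0, 1, 0], 1), (![0, 0, 2, 0], 1)])], []⟩])],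
  [((⟨[(![0, 0, 0, 3], 1), (![0, 0, 1, 1], 1)], ![0, 0, 0, 0], ∅⟩, {2, 3}), [⟨2, 0, 1, [(![0, 0, 1, 0], [(![1, 0, 2, 1], 1)]), (![0, 0, 0, 1], [(![1, 0, 0, 0], 1), (![1, 0, 1, 2], 1), (![2, 0, 0, 0], 1)])], [(![2, 0, 0, 2], 1)]⟩, ⟨2, 1, 1, [(![0, 0, 1, 0], [(![0, 1, 2, 1], 1)]), (![0, 0, 0, 1], [(![0, 1, 0, 0], 1), (![0, 1, 1, 2], 1), (![0, 2, 0, 0], 1)])], [(![0, 2, 0, 2], 1)]⟩, ⟨2, 3, 1, [(![0, 0, 1, 0], [(![0, 0, 1, 0], 1), (![0, 0, 1, 1], 1)]), (![0, 0, 0, 1], [(![0, 0, 0, 1], 1), (![0, 0, 0, 2], 1)])], []⟩, ⟨3, 0, 1, [(![0, 0, 1, 0], [(![1, 0, 0, 0], 1), (![2, 0, 0, 0], 1)])], []⟩, ⟨3, 1, 1, [(![0, 0, 1, 0], [(![0, 1, 0, 0], 1), (![0, 2, 0, 0], 1)])], []⟩, ⟨3, 2, 1, [(![0, 0, 1, 0],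 [(![0, 0, 1, 0], 1), (![0, 0, 2, 0], 1)])], []⟩])],
  [((⟨[(![0, 0, 0, 3], 1), (![0, 0, 1, 2], 1)], ![0, 0, 0, 0], ∅⟩, {3}), [⟨3, 0, 1, [(![0, 0, 1, 0], [(![1, 0, 0, 0], 1), (![2, 0, 0, 0], 1)])], []⟩, ⟨3, 1, 1, [(![0, 0, 1, 0], [(![0, 1, 0, 0], 1), (![0, 2, 0, 0], 1)])], []⟩, ⟨3, 2, 1, [(![0, 0, 1, 0], [(![0, 0, 1, 0], 1), (![0, 0, 2, 0], 1)])], []⟩])]]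

/-- The three certificates pass the all-fields checker (`p = q = 2`). [OURS · ‖ K] [folklore] -/
theorem uwinCertB_ucertsW1a : ucertsW1a.all (uwinCertB 2 2) = true := by
  decide +kernel

/-- **Over EVERY field `K` of characteristic 2, every row state of the three certificates — in particular the
three band roots `x₃x₄³ + x₁x₂x₄²`, `x₄³ + x₃x₄`, `x₄³ + x₃x₄²` — is ESCAPABLE in the full coordinate game with B
ranging over all of `K⁴`.** No «over 𝔽₂» rider for these. [OURS · ‖ K] [folklore] -/
theorem forall_stateWins_ucertsW1a (K : Type) [Field K] [CharP K 2] [DecidableEq K] :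
    ∀ T ∈ ucertsW1a, ∀ row ∈ T, StateWins 2
      (⟨MvPolynomial.map (ZMod.castHom (dvd_refl 2) K) row.1.1.toState.F, row.1.1.toState.r,
        row.1.1.toState.exc⟩ : State K) :=
  fun T hT => forall_stateWins_of_uwinCertB (List.all_eq_true.mp uwinCertB_ucertsW1a T hT) K

end WinCertAllFields
end Summit.ResolutionOfSingularities.ResolutionOfSingularities.Theorems.PIDim4
end
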